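import Mathlib

/-!
# A 20-regular circulant whose every half spans more than `n` edges (crux `FoolingMeasure`, kill-side bookkeeping)

FRONTIER restricted-model rung (AEA cut rectangles, route `AeaCutRectangles`, crux X1 `FoolingMeasure` = stmt-PneNP-19727);
nothing here bears on `P` versus `NP`.  Landed for the crux-ideate seats (Cruxes/FoolingMeasure/SubgroupCirculantsSketch.lean,
card `cyclotomic-coset-circulants`), PROVED CONTENT ONLY.

The standing conditional kill of X1 is `foolingMeasure_false_of_halfSparseCore : HalfSparseCore → ¬ FoolingMeasure`
(`Theorems/FoolingMeasure/Negative/`), with `HalfSparseCore` = «every 4-critical graph on `f` vertices has `≥ f/2` vertices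
spanning `≤ f/2` of its edges».  A refutation of `HalfSparseCore` needs a loopless, non-3-colourable, edge-critical edge set
all of whose `≥ n/2`-vertex sets span `> n/2` edges (the crux directory's `ExcessTemplate`; a 1-fold template already refutes
`HalfSparseCore`).  This file — route-independent, `import Mathlib` only; «edges of `G` inside `T`» is spelled
`G.edgeFinset.filter (∀ v ∈ ·, v ∈ T)`, definitionally the route's `bobSide T G.edgeFinset` — kernel-checks the DENSITY half of
such a witness with LINEAR room, for the explicit 20-regular circulant
`W₂₀ = Cay(ℤ/477691, ±{1, b, b², b³, b⁴} ∪ ±c{1, b, b², b³, b⁴})`, `b = 380423` (`b⁵ = −1`), `c = 21890`: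

* `coset_pentagon_relation`: `b⁵ = −1`, `1 + b` a unit ⇒ `c − cb + cb² − cb³ + cb⁴ = 0` (the cyclotomic identity
  `(1+b)(1−b+b²−b³+b⁴) = 1+b⁵`), so each coset closes into translates of a pentagon;
* `zeroSum_pentagon_bound` (NON-ABELIAN, any five permutations `s₀,…,s₄` of a finite type with closing alternating product and
  pairwise distinct class edges): every vertex set `T` spans at least `5|T| − 2|V|` class edges (double counting of the closed
  5-walks: a walk meeting `T` in `k` slots has `≥ k − 2` edges inside `T`);
* `w20_linearExcess`: every `T ⊆ ℤ/477691` with `2|T| ≥ n` spans MORE THAN `n` edges of `W₂₀` (two disjoint pentagon systems give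
  `≥ 2(5|T| − 2n) ≥ n + 5`) — twice the `HalfSparseCore` threshold.
NOT here (open obligations of the witness, recorded in the crux directory): non-3-colourability of `W₂₀` (no-middle-third scan +
SAT certificates, kit) and edge-criticality.  So this file does NOT refute `HalfSparseCore`; it supplies the half-density brick.
-/

set_option linter.dupNamespace false -- `Summit.PneNP.PneNP.…`: summit = sub-problem name (D-0017 single-conjunct layout)

namespace Summit.PneNP.PneNP.Theorems.AeaCutRectanglesW20LinearExcess

open Finset SimpleGraph

-- adapted from Cruxes/FoolingMeasure/SubgroupCirculantsSketch.lean (crux-ideate seat 1 g4, stmt-PneNP-19727), proved parts only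

/-! ## The cyclotomic pentagon relation -/

/-- the cyclotomic identity behind the free pentagon relations. -/
theorem alt_sum_mul {R : Type*} [CommRing R] (b : R) :
    (1 + b) * (1 - b + b ^ 2 - b ^ 3 + b ^ 4) = 1 + b ^ 5 := by ring

/-- FIRST LEMMA (proved): if `b⁵ = -1` and `1 + b` is a unit, every coset representative `c` carries the signed
zero-sum pentagon relation `c - cb + cb² - cb³ + cb⁴ = 0`; so the five classes `c, cb, cb², cb³, cb⁴` of the
circulant close up into `n` translates of a 5-cycle. -/
theorem coset_pentagon_relation {R : Type*} [CommRing R] (b c : R) (hb : b ^ 5 = -1) (hu : IsUnit (1 + b)) :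
    c - c * b + c * b ^ 2 - c * b ^ 3 + c * b ^ 4 = 0 := by
  have h : (1 + b) * (c * (1 - b + b ^ 2 - b ^ 3 + b ^ 4)) = 0 := by
    calc (1 + b) * (c * (1 - b + b ^ 2 - b ^ 3 + b ^ 4))
        = c * ((1 + b) * (1 - b + b ^ 2 - b ^ 3 + b ^ 4)) := by ring
      _ = c * (1 + b ^ 5) := by rw [alt_sum_mul]
      _ = 0 := by rw [hb]; ring
  have h' : c * (1 - b + b ^ 2 - b ^ 3 + b ^ 4) = 0 := (hu.mul_right_eq_zero).mp h
  linear_combination h'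


section CosetPairWitness
/-! ### The linear-excess witness `W₂₀(477691)` (crux-ideate seat 1, kit j295875)
`n = 477691 = 41·61·191 ≡ 1 (mod 3)`, `b = 380423` (`b⁵ = -1`), `c = 21890`;
`S = P ∪ cP = {1, 9557, 21890, 68225, 233915, 349958, 380423, 393569, 451763, 474101}` (least residues; as classes
up to sign `{1, 3590, 9557, 84122, 97268} ∪ {21890, 25928, 68225, 127733, 233915}`).
Checked by exact integer arithmetic (kit j295875 / local): near-miss (all 90 ordered ratios `≡ 2 (mod 3)`);
NO `t ∈ ℤ/n` (units and non-units) puts `tS` inside the middle third (so not 3-colourable, by R3T); both cosets close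
into pentagons with 5 distinct vertices and the 10 classes are pairwise distinct: `e(T) ≥ 2(5|T| - 2n)` for every `T`,
`= n + 5 = 477696` at `|T| = ⌈n/2⌉` (threshold `n/2 = 238845.5`; best arc half found: `499191`). -/

/-- modulus of the coset-pair witness. -/
abbrev Nw : ℕ := 477691


/-- the cyclotomic generator and the coset multiplier. -/
abbrev bw : ZMod Nw := 380423
/-- the coset multiplier. -/
abbrev cw : ZMod Nw := 21890

/-- `b⁵ = -1`, and `1 + b` is a unit (explicit inverse), so `coset_pentagon_relation` applies to both cosets. -/
theorem bw_pow_five : bw ^ 5 = -1 := by decide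

/-- connection set (one representative per `±` class, least residues as found). -/
def w20S : Finset (ZMod Nw) := {1, 9557, 21890, 68225, 233915, 349958, 380423, 393569, 451763, 474101}

/-- the witness graph, a 20-regular circulant. -/
abbrev w20G : SimpleGraph (ZMod Nw) := circulantGraph (w20S : Set (ZMod Nw))


end CosetPairWitness


/-! ## Zero-sum pentagon bound — NON-ABELIAN form (g4 addendum; transplants the lever to seat 2's normal cycle systems)

Five permutations `s₀,…,s₄` of a finite vertex type whose alternating product CLOSES, `s₄ ∘ s₃⁻¹ ∘ s₂ ∘ s₁⁻¹ ∘ s₀ = 1`,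
make every start vertex `x` the base of a closed 5-walk `x, s₀x, s₁⁻¹s₀x, s₂s₁⁻¹s₀x, s₃⁻¹s₂s₁⁻¹s₀x, x` using one edge of
each class `{y, sᵢ y}`; the walks use each of the `5|V|` class edges exactly once and fill every vertex slot bijectively.
Consequently EVERY vertex set `T` spans at least `5|T| - 2|V|` class edges (no commutativity and no simplicity of the
walks needed — only that the `5|V|` class edges are pairwise distinct).  PROVED below (`zeroSum_pentagon_bound`), then
specialised to translation tuples and to the witness `W₂₀(477691)` (`w20_linearExcess`). -/

section ZeroSum

variable {V : Type*} [Fintype V] [DecidableEq V]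

/-- `j`-th vertex map of the closed 5-walks. -/
def wv (s : Fin 5 → Equiv.Perm V) : Fin 5 → Equiv.Perm V :=
  ![1, s 0, (s 1)⁻¹ * s 0, s 2 * ((s 1)⁻¹ * s 0), (s 3)⁻¹ * (s 2 * ((s 1)⁻¹ * s 0))]

/-- `(j+1)`-st vertex map of the 5-walks (the walks close iff `wn s 4 = 1`). -/
def wn (s : Fin 5 → Equiv.Perm V) : Fin 5 → Equiv.Perm V :=
  ![s 0, (s 1)⁻¹ * s 0, s 2 * ((s 1)⁻¹ * s 0), (s 3)⁻¹ * (s 2 * ((s 1)⁻¹ * s 0)),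
    s 4 * ((s 3)⁻¹ * (s 2 * ((s 1)⁻¹ * s 0)))]

/-- the class edges `{x, sᵢ x}` (as a finset of unordered pairs). -/
def classEdges (s : Fin 5 → Equiv.Perm V) : Finset (Sym2 V) :=
  Finset.univ.biUnion fun i => Finset.univ.image fun x => s(x, s i x)

/-- the `j`-th edge of the walk based at `x`. -/
def walkEdge (s : Fin 5 → Equiv.Perm V) (p : Fin 5 × V) : Sym2 V :=
  s(wv s p.1 p.2, wn s p.1 p.2)

/-- walk edges are class edges. -/
theorem walkEdge_mem (s : Fin 5 → Equiv.Perm V) (p : Fin 5 × V) :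
    walkEdge s p ∈ classEdges s := by
  obtain ⟨j, x⟩ := p
  simp only [classEdges, Finset.mem_biUnion, Finset.mem_univ, true_and, Finset.mem_image]
  fin_cases j
  · exact ⟨0, x, by simp [walkEdge, wv, wn]⟩
  · exact ⟨1, ((s 1)⁻¹ * s 0) x, by simp [walkEdge, wv, wn, Equiv.Perm.mul_apply]⟩
  · exact ⟨2, ((s 1)⁻¹ * s 0) x, by simp [walkEdge, wv, wn, Equiv.Perm.mul_apply]⟩
  · exact ⟨3, ((s 3)⁻¹ * (s 2 * ((s 1)⁻¹ * s 0))) x, by simp [walkEdge, wv, wn, Equiv.Perm.mul_apply]⟩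
  · exact ⟨4, ((s 3)⁻¹ * (s 2 * ((s 1)⁻¹ * s 0))) x, by simp [walkEdge, wv, wn, Equiv.Perm.mul_apply]⟩

/-- the walk edges exhaust the class edges. -/
theorem image_walkEdge (s : Fin 5 → Equiv.Perm V) :
    Finset.univ.image (walkEdge s) = classEdges s := by
  ext e
  constructor
  · intro he
    obtain ⟨p, -, rfl⟩ := Finset.mem_image.mp he
    exact walkEdge_mem s p
  · intro he
    simp only [classEdges, Finset.mem_biUnion, Finset.mem_univ, true_and, Finset.mem_image] at he
    obtain ⟨i, y, rfl⟩ := he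
    rw [Finset.mem_image]
    fin_cases i
    · exact ⟨(0, y), Finset.mem_univ _, by simp [walkEdge, wv, wn]⟩
    · exact ⟨(1, (s 0)⁻¹ (s 1 y)), Finset.mem_univ _, by simp [walkEdge, wv, wn, Equiv.Perm.mul_apply]⟩
    · exact ⟨(2, (s 0)⁻¹ (s 1 y)), Finset.mem_univ _, by simp [walkEdge, wv, wn, Equiv.Perm.mul_apply]⟩
    · exact ⟨(3, (s 0)⁻¹ (s 1 ((s 2)⁻¹ (s 3 y)))), Finset.mem_univ _,
        by simp [walkEdge, wv, wn, Equiv.Perm.mul_apply]⟩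
    · exact ⟨(4, (s 0)⁻¹ (s 1 ((s 2)⁻¹ (s 3 y)))), Finset.mem_univ _,
        by simp [walkEdge, wv, wn, Equiv.Perm.mul_apply]⟩

/-- distinctness of the `5|V|` class edges makes the walk-edge map injective. -/
theorem walkEdge_injective_of_card (s : Fin 5 → Equiv.Perm V)
    (hcard : (classEdges s).card = 5 * Fintype.card V) : Function.Injective (walkEdge s) := by
  have h : Set.InjOn (walkEdge s) ↑(Finset.univ : Finset (Fin 5 × V)) := by
    apply Finset.card_image_iff.mp
    rw [image_walkEdge, hcard, Finset.card_univ, Fintype.card_prod, Fintype.card_fin]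
  rwa [Finset.coe_univ, Set.injOn_univ] at h

omit [Fintype V] in
/-- per-walk count: a closed 5-walk meeting `T` in `k` of its five vertex slots has at least `k - 2` edges inside `T`. -/
theorem walk_count_le (s : Fin 5 → Equiv.Perm V)
    (hclose : s 4 * ((s 3)⁻¹ * (s 2 * ((s 1)⁻¹ * s 0))) = 1) (T : Finset V) (x : V) :
    (Finset.univ.filter fun j : Fin 5 => wv s j x ∈ T).card
      ≤ (Finset.univ.filter fun j : Fin 5 => wv s j x ∈ T ∧ wn s j x ∈ T).card + 2 := by
  have e0 : wn s 0 x = wv s 1 x := by simp [wv, wn]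
  have e1 : wn s 1 x = wv s 2 x := by simp [wv, wn]
  have e2 : wn s 2 x = wv s 3 x := by simp [wv, wn]
  have e3 : wn s 3 x = wv s 4 x := by simp [wv, wn]
  have e4 : wn s 4 x = wv s 0 x := by simp [wv, wn, hclose]
  rw [Finset.card_filter, Finset.card_filter, Fin.sum_univ_five, Fin.sum_univ_five, e0, e1, e2, e3, e4]
  by_cases h0 : wv s 0 x ∈ T <;> by_cases h1 : wv s 1 x ∈ T <;> by_cases h2 : wv s 2 x ∈ T <;>
    by_cases h3 : wv s 3 x ∈ T <;> by_cases h4 : wv s 4 x ∈ T <;> simp [h0, h1, h2, h3, h4]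

/-- the five vertex maps are bijections, so the slots in `T` number `5|T|` in total. -/
theorem sum_walk_count (s : Fin 5 → Equiv.Perm V) (T : Finset V) :
    ∑ x, (Finset.univ.filter fun j : Fin 5 => wv s j x ∈ T).card = 5 * T.card := by
  have key : ∀ σ : Equiv.Perm V, (∑ x, if σ x ∈ T then 1 else 0) = T.card := by
    intro σ
    rw [show (∑ x, if σ x ∈ T then 1 else 0) = ∑ y, if y ∈ T then 1 else 0 from
      Equiv.sum_comp σ (fun y => if y ∈ T then (1 : ℕ) else 0)]
    simp
  simp_rw [Finset.card_filter, Fin.sum_univ_five, Finset.sum_add_distrib, key]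
  ring

/-- ZERO-SUM PENTAGON BOUND (non-abelian): closure + pairwise distinct walk edges ⇒ every `T` spans `≥ 5|T| - 2|V|`
class edges. -/
theorem zeroSum_pentagon_bound (s : Fin 5 → Equiv.Perm V)
    (hclose : s 4 * ((s 3)⁻¹ * (s 2 * ((s 1)⁻¹ * s 0))) = 1)
    (hinj : Function.Injective (walkEdge s)) (T : Finset V) :
    5 * (T.card : ℤ) - 2 * Fintype.card V ≤ (((classEdges s).filter fun e => ∀ v ∈ e, v ∈ T).card : ℤ) := by
  set D : Finset (Fin 5 × V) :=
    Finset.univ.filter fun p => wv s p.1 p.2 ∈ T ∧ wn s p.1 p.2 ∈ T with hD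
  have h1 : D.card ≤ ((classEdges s).filter fun e => ∀ v ∈ e, v ∈ T).card := by
    rw [← Finset.card_image_of_injective D hinj]
    apply Finset.card_le_card
    intro e he
    rw [Finset.mem_image] at he
    obtain ⟨p, hp, rfl⟩ := he
    rw [hD, Finset.mem_filter] at hp
    rw [Finset.mem_filter]
    refine ⟨walkEdge_mem s p, ?_⟩
    intro v hv
    rw [walkEdge, Sym2.mem_iff] at hv
    rcases hv with rfl | rfl
    · exact hp.2.1
    · exact hp.2.2
  have hDsum : D.card = ∑ x, (Finset.univ.filter fun j : Fin 5 => wv s j x ∈ T ∧ wn s j x ∈ T).card := by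
    rw [hD, Finset.card_filter, Fintype.sum_prod_type, Finset.sum_comm]
    simp_rw [Finset.card_filter]
  have h2 : 5 * T.card ≤ D.card + 2 * Fintype.card V := by
    rw [hDsum, ← sum_walk_count s T]
    have hle := Finset.sum_le_sum (s := Finset.univ) fun x _ => walk_count_le s hclose T x
    have hc : ∑ x : V, ((Finset.univ.filter fun j : Fin 5 => wv s j x ∈ T ∧ wn s j x ∈ T).card + 2)
        = (∑ x : V, (Finset.univ.filter fun j : Fin 5 => wv s j x ∈ T ∧ wn s j x ∈ T).card)
          + 2 * Fintype.card V := by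
      rw [Finset.sum_add_distrib]; simp [mul_comm]
    omega
  omega

end ZeroSum

/-! ### Translation tuples (the circulant case) and the kernel-checked half-density of `W₂₀(477691)` -/

section Translations

variable {A : Type*} [CommRing A] [Fintype A] [DecidableEq A]

/-- translation 5-tuple with steps `t j`. -/
def tr5 (t : Fin 5 → A) : Fin 5 → Equiv.Perm A := fun j => Equiv.addRight (t j)

omit [Fintype A] [DecidableEq A] in
/-- inverse of a translation. -/
theorem addRight_inv_apply (a x : A) : (Equiv.addRight a)⁻¹ x = x - a := by
  rw [Equiv.Perm.inv_def, Equiv.symm_apply_eq]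
  simp

omit [Fintype A] [DecidableEq A] in
/-- alternating zero sum of the steps ⇒ the translation walks close. -/
theorem tr5_close (t : Fin 5 → A) (h : t 0 - t 1 + t 2 - t 3 + t 4 = 0) :
    tr5 t 4 * ((tr5 t 3)⁻¹ * (tr5 t 2 * ((tr5 t 1)⁻¹ * tr5 t 0))) = 1 := by
  ext x
  simp only [tr5, Equiv.Perm.mul_apply, addRight_inv_apply, Equiv.coe_addRight, Equiv.Perm.coe_one, id_eq]
  linear_combination h

/-- `±`-distinct steps with `2 t j ≠ 0` give `5|A|` distinct class edges. -/
theorem classEdges_tr5_card (t : Fin 5 → A)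
    (hd : ∀ i j, i ≠ j → t i ≠ t j ∧ t i ≠ -t j) (h2 : ∀ i, t i + t i ≠ 0) :
    (classEdges (tr5 t)).card = 5 * Fintype.card A := by
  rw [classEdges, Finset.card_biUnion]
  · have hc : ∀ i, (Finset.univ.image fun x => s(x, tr5 t i x)).card = Fintype.card A := by
      intro i
      rw [Finset.card_image_of_injective _ ?_, Finset.card_univ]
      intro x y hxy
      simp only [tr5, Equiv.coe_addRight, Sym2.eq_iff] at hxy
      rcases hxy with ⟨h, _⟩ | ⟨h1, h3⟩
      · exact h
      · exfalso; exact h2 i (by linear_combination h3 - h1)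
    simp [hc]
  · intro i _ j _ hij
    dsimp only [Function.onFun]
    rw [Finset.disjoint_left]
    intro e hei hej
    simp only [Finset.mem_image, Finset.mem_univ, true_and, tr5, Equiv.coe_addRight] at hei hej
    obtain ⟨x, rfl⟩ := hei
    obtain ⟨y, hy⟩ := hej
    rw [Sym2.eq_iff] at hy
    rcases hy with ⟨h1, h3⟩ | ⟨h1, h3⟩
    · exact (hd i j hij).1 (by linear_combination h1 - h3)
    · exact (hd i j hij).2 (by linear_combination h3 - h1)

/-- class edges of two `±`-separated tuples are disjoint. -/
theorem classEdges_tr5_disjoint (t t' : Fin 5 → A) (hd : ∀ i j, t i ≠ t' j ∧ t i ≠ -t' j) :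
    Disjoint (classEdges (tr5 t)) (classEdges (tr5 t')) := by
  rw [Finset.disjoint_left]
  intro e he he'
  simp only [classEdges, Finset.mem_biUnion, Finset.mem_univ, true_and, Finset.mem_image, tr5,
    Equiv.coe_addRight] at he he'
  obtain ⟨i, x, rfl⟩ := he
  obtain ⟨j, y, hy⟩ := he'
  rw [Sym2.eq_iff] at hy
  rcases hy with ⟨h1, h3⟩ | ⟨h1, h3⟩
  · exact (hd i j).1 (by linear_combination h1 - h3)
  · exact (hd i j).2 (by linear_combination h3 - h1)

end Translations

section W20Density

/-- the first step tuple of `W₂₀(477691)`: `bʲ`. -/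
def tP : Fin 5 → ZMod Nw := ![1, bw, bw ^ 2, bw ^ 3, bw ^ 4]

/-- the second step tuple of `W₂₀(477691)`: `c bʲ`. -/
def tC : Fin 5 → ZMod Nw := ![cw, cw * bw, cw * bw ^ 2, cw * bw ^ 3, cw * bw ^ 4]

/-- the `bʲ` steps have alternating zero sum (pentagon relation). -/
theorem tP_close : tP 0 - tP 1 + tP 2 - tP 3 + tP 4 = 0 := by decide
/-- the `c bʲ` steps have alternating zero sum. -/
theorem tC_close : tC 0 - tC 1 + tC 2 - tC 3 + tC 4 = 0 := by decide
/-- the `bʲ` steps are pairwise `±`-distinct. -/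
theorem tP_dist : ∀ i j : Fin 5, i ≠ j → tP i ≠ tP j ∧ tP i ≠ -tP j := by decide
/-- the `c bʲ` steps are pairwise `±`-distinct. -/
theorem tC_dist : ∀ i j : Fin 5, i ≠ j → tC i ≠ tC j ∧ tC i ≠ -tC j := by decide
/-- no `bʲ` step has order two (`n` is odd). -/
theorem tP_two : ∀ i : Fin 5, tP i + tP i ≠ 0 := by decide
/-- no `c bʲ` step has order two. -/
theorem tC_two : ∀ i : Fin 5, tC i + tC i ≠ 0 := by decide
/-- the two tuples are `±`-separated. -/
theorem tPC_dist : ∀ i j : Fin 5, tP i ≠ tC j ∧ tP i ≠ -tC j := by decide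
/-- the `bʲ` steps are connection classes of the witness. -/
theorem tP_mem : ∀ i : Fin 5, tP i ∈ w20S ∨ -tP i ∈ w20S := by decide
/-- the `c bʲ` steps are connection classes of the witness. -/
theorem tC_mem : ∀ i : Fin 5, tC i ∈ w20S ∨ -tC i ∈ w20S := by decide
/-- the `bʲ` steps are nonzero. -/
theorem tP_ne : ∀ i : Fin 5, tP i ≠ 0 := by decide
/-- the `c bʲ` steps are nonzero. -/
theorem tC_ne : ∀ i : Fin 5, tC i ≠ 0 := by decide

/-- class edges inside `T` are edges of the witness inside `T`. -/
theorem classEdges_subset_inside (t : Fin 5 → ZMod Nw) (hmem : ∀ i, t i ∈ w20S ∨ -t i ∈ w20S)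
    (h0 : ∀ i, t i ≠ 0) (T : Finset (ZMod Nw)) :
    ((classEdges (tr5 t)).filter fun e => ∀ v ∈ e, v ∈ T) ⊆ w20G.edgeFinset.filter (fun e => ∀ v ∈ e, v ∈ T) := by
  intro e he
  rw [Finset.mem_filter] at he
  rw [Finset.mem_filter]
  refine ⟨?_, he.2⟩
  obtain ⟨he1, -⟩ := he
  simp only [classEdges, Finset.mem_biUnion, Finset.mem_univ, true_and, Finset.mem_image, tr5,
    Equiv.coe_addRight] at he1
  obtain ⟨i, x, rfl⟩ := he1
  rw [SimpleGraph.mem_edgeFinset, SimpleGraph.mem_edgeSet]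
  simp only [w20G, circulantGraph, SimpleGraph.fromRel_adj, Finset.mem_coe]
  refine ⟨fun h => h0 i (by linear_combination -h), ?_⟩
  rcases hmem i with h | h
  · right; simpa using h
  · left; simpa using h

/-- **LINEAR EXCESS of `W₂₀(477691)`**: every vertex set `T` with `2|T| ≥ n` spans more than `n` edges of the witness
(in fact `≥ n + 5`: two disjoint pentagon systems give `≥ 2(5|T| − 2n)` each counted once) — twice the `HalfSparseCore`
threshold `n/2`.  Restricted-model bookkeeping for crux `FoolingMeasure`; says nothing about `P` versus `NP`. -/
theorem w20_linearExcess (T : Finset (ZMod Nw)) (hT : Nw ≤ 2 * T.card) :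
    2 * Nw < 2 * (w20G.edgeFinset.filter fun e => ∀ v ∈ e, v ∈ T).card := by
  have hb1 := zeroSum_pentagon_bound (tr5 tP) (tr5_close tP tP_close)
    (walkEdge_injective_of_card _ (classEdges_tr5_card tP tP_dist tP_two)) T
  have hb2 := zeroSum_pentagon_bound (tr5 tC) (tr5_close tC tC_close)
    (walkEdge_injective_of_card _ (classEdges_tr5_card tC tC_dist tC_two)) T
  have hsub : ((classEdges (tr5 tP)).filter fun e => ∀ v ∈ e, v ∈ T) ∪
      ((classEdges (tr5 tC)).filter fun e => ∀ v ∈ e, v ∈ T) ⊆ w20G.edgeFinset.filter (fun e => ∀ v ∈ e, v ∈ T) :=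
    Finset.union_subset (classEdges_subset_inside tP tP_mem tP_ne T)
      (classEdges_subset_inside tC tC_mem tC_ne T)
  have hdisj : Disjoint ((classEdges (tr5 tP)).filter fun e => ∀ v ∈ e, v ∈ T)
      ((classEdges (tr5 tC)).filter fun e => ∀ v ∈ e, v ∈ T) :=
    (classEdges_tr5_disjoint tP tC tPC_dist).mono (Finset.filter_subset _ _) (Finset.filter_subset _ _)
  have hcard := Finset.card_le_card hsub
  rw [Finset.card_union_of_disjoint hdisj] at hcard
  have hV : Fintype.card (ZMod Nw) = Nw := ZMod.card Nw
  have hodd : Nw % 2 = 1 := by decide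
  rw [hV] at hb1 hb2
  omega

end W20Density

end Summit.PneNP.PneNP.Theorems.AeaCutRectanglesW20LinearExcess
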